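import Mathlib
import Literature.Computability.AlgebraicComplexity.NestFreeMatchingFifo
import Summits.ValiantsHypothesis.ValiantsHypothesis.Theorems.FifoMatchingNFPolytopeQueueGridFaceDefs
import HarnessLib

/-!
# Route `FifoMatching`, item `NFPolytopeQuasiPolyXC` (K1, stmt-ValiantsHypothesis-26254), line `queue_grid_face`
# (val-idea-7 g6, `Cruxes/NNLinearDegreeCofactorHard/Lines/queue_grid_face.lean`): INPUT (A) — the gadget, DEFINITIONS

Input (A) of the line is `QueueGridFaceProjection`: for `r ≥ 1` and `n ≥ (r+1)(2r+1)` a coordinate face of the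
nest-free perfect-matching polytope `NFP(2n) = Newt(NN_n)` projects, by coordinate restriction, EXACTLY onto the
pair-pattern polytope `PP_r = queueGridPP r` of the `r × r` queue grid (memo
`Lines/internal_cofactor-NEXT-RUNG-dual.md` §8.3, "layout B").  This file fixes the vocabulary of the proof; the proofs are
in the sequel files `FifoMatchingNFPolytopeQueueGridGadget{Positions,Counts,Designs,Windows,Rigidity}.lean`.

* The line's own vocabulary (`realOf`, `suppPts`, `newt`, `QGV`, `qgEdge`, `patternVec`, `queueGridPP`) is NOT copied
  again: the Theorems-side verbatim copies live in c1 g5's `FifoMatchingNFPolytopeQueueGridFaceDefs.lean` (namespace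
  `…Theorems.FifoMatching.QueueGridFace`, imported here; director-valiant R155), so the closing theorem
  (`FifoMatchingNFPolytopeQueueGridFaceProjection.lean`) states the body of the line's `QueueGridFaceProjection` in that
  ONE vocabulary and the line file closes input (A) by `exact`.
* LAYOUT B on `2 n` points, `n = (r+1)(2r+1) + d` (`d` = padding pairs): the queue word
  `U^{2r+1} · Π_{s<r} [ U · W(s,0) ⋯ W(s,r-1) · D ] · D^{2r+1} · (UD)^d`, window `W(s,i) = UUDD` (bit `1`) or `DDUU`
  (bit `0`).  Positions are the symbolic type `QPos r d` — preamble `pre j`, frame `frU s`, window slot `slot s i t`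
  (`t < 4`), frame `frD s`, postamble `post j`, padding `pad j` — with its position `QPos.toNat` and the decoding
  `QPos.ofFin` (an `Equiv` in the sequel).
* ALLOWED ARCS `E′` (`QPos.adj`): one rule in the "virtual cell coordinates" `QPos.vc = (S, i′, t)` (stretch `S = s+1`,
  column `i′ = i+1`, slot `t`; the frame `U` of stretch `s` is the virtual slot `(s+1, 0, 3)`, the frame `D` the virtual
  slot `(s+1, r+1, 0)`, the preamble is virtual stretch `0`, the postamble virtual stretch `r+1`): an arc goes from
  `(S, i′, t)` to `(S+1, i′, t′)` with `t` even, `t′` odd (first push of a window → second pop of the window below) or to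
  `(S+1, i′+1, t′)` with `t` odd, `t′` even (second push → first pop of the window below-right); plus the padding arcs
  `pad 2u → pad (2u+1)`.  Enumeration (`|E′| = 10, 34, 74` for `r = 1, 2, 3`) and the rigidity of §8.3 were re-checked
  by exhaustive search for `r ≤ 3`, `d ≤ 2` before typing (val-idea-7 / crit-3 checked `r ≤ 4`).
* The DESIGN WORD `word X` of a bit matrix `X : Fin r × Fin r → Bool` (`isU`), its closed-form prefix counts `cU`
  (number of pushes strictly before a position), the designed closer `partner X x` of a push `x`, and the symbolic
  predecessor `predQ` used by the prefix-count induction.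

Honest framing: definitions only; nothing here asserts anything.  The target `NFPolytopeQuasiPolyXC` (K1) also needs
input (B) (`QueueGridPPHard`, print: Avis–Tiwary 2015 + Robertson–Seymour–Thomas 1994), not touched here; K1, HD-1,
`NNDivisionHard` stay open and VP ≠ VNP is NOT proved by anything in this line (monotone / polyhedral world).
-/

-- Sub = Summit single-conjunct layout: the duplicated namespace component is mandated by the tree.
set_option linter.dupNamespace false

namespace Summit.ValiantsHypothesis.ValiantsHypothesis.Theorems.FifoMatching.NFPolytopeQuasiPolyXC.QueueGridFace

open Finset Literature.Computability.AlgebraicComplexity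
open Summit.ValiantsHypothesis.ValiantsHypothesis.Theorems.FifoMatching.QueueGridFace (QGV)

/-! ## Layout B: symbolic positions -/

/-- half the length of the layout-B word with `d` padding pairs: `n = (r+1)(2r+1) + d` -/
abbrev half (r d : ℕ) : ℕ := (r + 1) * (2 * r + 1) + d

/-- Symbolic positions of the layout-B word on `2 · half r d` points: preamble letters `pre j` (`j < 2r+1`), the frame
push `frU s` of stretch `s < r`, slot `t < 4` of window `(s, i)`, the frame pop `frD s`, postamble letters `post j`,
padding letters `pad j` (`j < 2d`). -/
inductive QPos (r d : ℕ) : Type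
  | pre (j : Fin (2 * r + 1))
  | frU (s : Fin r)
  | slot (s i : Fin r) (t : Fin 4)
  | frD (s : Fin r)
  | post (j : Fin (2 * r + 1))
  | pad (j : Fin (2 * d))
  deriving DecidableEq, Fintype

namespace QPos

variable {r d : ℕ}

/-- The position (in `ℕ`) of a symbolic position: preamble `0 … 2r`, stretch `s` occupies
`(2r+1) + s(4r+2) … (2r+1) + s(4r+2) + 4r+1` (frame `U`, `r` windows of `4`, frame `D`), postamble from `(2r+1)²`,
padding from `2(r+1)(2r+1)`. -/
def toNat : QPos r d → ℕ
  | pre j => j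
  | frU s => (2 * r + 1) + s * (4 * r + 2)
  | slot s i t => (2 * r + 1) + s * (4 * r + 2) + (4 * i + t + 1)
  | frD s => (2 * r + 1) + s * (4 * r + 2) + (4 * r + 1)
  | post j => (2 * r + 1) * (2 * r + 1) + j
  | pad j => 2 * ((r + 1) * (2 * r + 1)) + j

/-- arithmetic: one stretch further still fits below `r` stretches -/
theorem stretch_le {s : ℕ} (hs : s < r) : s * (4 * r + 2) + (4 * r + 2) ≤ r * (4 * r + 2) := by
  calc s * (4 * r + 2) + (4 * r + 2) = (s + 1) * (4 * r + 2) := by ring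
    _ ≤ r * (4 * r + 2) := Nat.mul_le_mul_right _ hs

/-- arithmetic: `(2r+1)² = (2r+1) + r(4r+2)` -/
theorem sq_eq (r : ℕ) : (2 * r + 1) * (2 * r + 1) = (2 * r + 1) + r * (4 * r + 2) := by ring

/-- arithmetic: `2(r+1)(2r+1) = (2r+1)² + (2r+1)` -/
theorem two_mul_eq (r : ℕ) : 2 * ((r + 1) * (2 * r + 1)) = (2 * r + 1) * (2 * r + 1) + (2 * r + 1) := by ring

/-- Every symbolic position lies below `2 · half r d`. -/
theorem toNat_lt (x : QPos r d) : x.toNat < 2 * half r d := by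
  have h2 := two_mul_eq r
  have hsq := sq_eq r
  have hh : 2 * half r d = 2 * ((r + 1) * (2 * r + 1)) + 2 * d := by simp only [half]; ring
  cases x with
  | pre j => have := j.isLt; simp only [toNat]; omega
  | frU s => have := stretch_le (r := r) s.isLt; simp only [toNat]; omega
  | slot s i t =>
    have := stretch_le (r := r) s.isLt; have := i.isLt; have := t.isLt; simp only [toNat]; omega
  | frD s => have := stretch_le (r := r) s.isLt; simp only [toNat]; omega
  | post j => have := j.isLt; simp only [toNat]; omega
  | pad j => have := j.isLt; simp only [toNat]; omega

/-- The position of a symbolic position, as an element of `Fin (2 · half r d)`. -/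
def toFin (x : QPos r d) : Fin (2 * half r d) := ⟨x.toNat, x.toNat_lt⟩

/-- Decoding an offset `q < r(4r+2)` into the stretches block: stretch `q / (4r+2)`, and inside the stretch offset
`u = q % (4r+2)`: `u = 0` the frame `U`, `u = 4r+1` the frame `D`, otherwise slot `(u-1) % 4` of window `(u-1) / 4`. -/
def ofStretch (q : ℕ) (hq : q < r * (4 * r + 2)) : QPos r d :=
  have hs : q / (4 * r + 2) < r := Nat.div_lt_of_lt_mul (hq.trans_eq (Nat.mul_comm _ _))
  have hu : q % (4 * r + 2) < 4 * r + 2 := Nat.mod_lt _ (by omega)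
  if h0 : q % (4 * r + 2) = 0 then frU ⟨q / (4 * r + 2), hs⟩
  else if h1 : q % (4 * r + 2) = 4 * r + 1 then frD ⟨q / (4 * r + 2), hs⟩
  else slot ⟨q / (4 * r + 2), hs⟩ ⟨(q % (4 * r + 2) - 1) / 4, by omega⟩ ⟨(q % (4 * r + 2) - 1) % 4, by omega⟩

/-- Decoding a position `p < 2 · half r d` into its symbolic position (inverse of `toFin`, see
`FifoMatchingNFPolytopeQueueGridGadgetPositions.lean`). -/
def ofFin (p : Fin (2 * half r d)) : QPos r d :=
  if h₁ : p.val < 2 * r + 1 then pre ⟨p.val, h₁⟩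
  else if h₂ : p.val - (2 * r + 1) < r * (4 * r + 2) then ofStretch (p.val - (2 * r + 1)) h₂
  else if h₃ : p.val - (2 * r + 1) * (2 * r + 1) < 2 * r + 1 then post ⟨_, h₃⟩
  else pad ⟨p.val - 2 * ((r + 1) * (2 * r + 1)), by
    have hp := p.isLt
    have h2 : 2 * half r d = 2 * ((r + 1) * (2 * r + 1)) + 2 * d := by simp only [half]; ring
    have h3 := two_mul_eq r
    omega⟩

/-- VIRTUAL CELL COORDINATES `(S, i′, t)`: stretch `S ∈ [0, r+1]` (`0` = preamble, `r+1` = postamble), column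
`i′ ∈ [0, r+1]` (`0` = frame `U`, `r+1` = frame `D`), slot `t`.  Preamble letter `j` is the virtual push
`(0, ⌈j/2⌉, 2 + (j+1) mod 2)` and postamble letter `j` the virtual pop `(r+1, j/2 + 1, j mod 2)`, so that the single
arc rule `adjV` below reproduces all arcs of all designs.  (Padding: unused junk value.) -/
def vc : QPos r d → ℕ × ℕ × ℕ
  | pre j => (0, (j.val + 1) / 2, 2 + (j.val + 1) % 2)
  | frU s => (s.val + 1, 0, 3)
  | slot s i t => (s.val + 1, i.val + 1, t.val)
  | frD s => (s.val + 1, r + 1, 0)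
  | post j => (r + 1, j.val / 2 + 1, j.val % 2)
  | pad j => (r + 2, j.val, 0)

/-- The arc rule in virtual coordinates: `(S, i′, t) → (S+1, i′, t′)` with `t` even, `t′` odd (first push of a window is
popped second in the window below), or `(S, i′, t) → (S+1, i′+1, t′)` with `t` odd, `t′` even (second push is popped
first in the window below-right). -/
def adjV (a b : ℕ × ℕ × ℕ) : Bool :=
  (b.1 == a.1 + 1) &&
    ((b.2.1 == a.2.1 && a.2.2 % 2 == 0 && b.2.2 % 2 == 1) || (b.2.1 == a.2.1 + 1 && a.2.2 % 2 == 1 && b.2.2 % 2 == 0))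

/-- The ALLOWED ARCS `E′` of layout B, as a relation on symbolic positions (first argument = opener): the virtual-cell
rule `adjV` between non-padding positions, and `pad (2u) → pad (2u+1)`. -/
def adj : QPos r d → QPos r d → Bool
  | pad j, pad j' => j.val % 2 == 0 && j'.val == j.val + 1
  | pad _, _ => false
  | _, pad _ => false
  | x, y => adjV x.vc y.vc

/-! ## The design word of a bit matrix and its bookkeeping -/

/-- The letter (`true` = push `U`) of the design word of `X` at a symbolic position: preamble and frame-`U` push,
frame-`D` and postamble pop, padding alternates `U D`, and window `(s, i)` reads `UUDD` if `X (s,i)` else `DDUU`. -/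
def isU (X : Fin r × Fin r → Bool) : QPos r d → Bool
  | pre _ => true
  | frU _ => true
  | slot s i t => decide (t.val < 2) == X (s, i)
  | frD _ => false
  | post _ => false
  | pad j => decide (j.val % 2 = 0)

/-- number of pushes among the first `t` slots of a window with bit `b` (`UUDD`: `min t 2`; `DDUU`: `t - 2`) -/
def uw (b : Bool) (t : ℕ) : ℕ := if b then min t 2 else t - 2

/-- CLOSED FORM of the number of pushes of the design word of `X` strictly before a symbolic position. -/
def cU (X : Fin r × Fin r → Bool) : QPos r d → ℕ
  | pre j => j
  | frU s => (2 * r + 1) * (s + 1)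
  | slot s i t => (2 * r + 1) * (s + 1) + 1 + 2 * i + uw (X (s, i)) t
  | frD s => (2 * r + 1) * (s + 1) + 1 + 2 * r
  | post _ => (r + 1) * (2 * r + 1)
  | pad j => (r + 1) * (2 * r + 1) + (j + 1) / 2

/-- slot of the FIRST push `U₁` of a window with bit `b` -/
def uSlot₁ (b : Bool) : Fin 4 := if b then 0 else 2
/-- slot of the SECOND push `U₂` of a window with bit `b` -/
def uSlot₂ (b : Bool) : Fin 4 := if b then 1 else 3
/-- slot of the FIRST pop `D₁` of a window with bit `b` -/
def dSlot₁ (b : Bool) : Fin 4 := if b then 2 else 0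
/-- slot of the SECOND pop `D₂` of a window with bit `b` -/
def dSlot₂ (b : Bool) : Fin 4 := if b then 3 else 1

/-- The DESIGNED CLOSER of a push `x` in the design of `X` (FIFO: preamble letter `2i`/`2i+1` is popped by the
first/second pop of window `(0,i)`, letter `2r` by the frame `D` of stretch `0`; the frame `U` of stretch `s` by the first
pop of window `(s+1, 0)`; the first push of window `(s,i)` by the second pop of window `(s+1,i)`, the second push by the
first pop of window `(s+1,i+1)` — of the frame `D` when `i = r-1`; the last stretch is popped by the postamble in order;
`pad 2u` by `pad (2u+1)`).  Junk (unused) at pops. -/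
def partner (X : Fin r × Fin r → Bool) : QPos r d → QPos r d
  | pre j =>
    if h : j.val / 2 < r then
      (if j.val % 2 = 0 then slot ⟨0, by omega⟩ ⟨_, h⟩ (dSlot₁ (X (⟨0, by omega⟩, ⟨_, h⟩)))
        else slot ⟨0, by omega⟩ ⟨_, h⟩ (dSlot₂ (X (⟨0, by omega⟩, ⟨_, h⟩))))
    else if h' : 0 < r then frD ⟨0, h'⟩ else post ⟨0, by omega⟩
  | frU s =>
    if h : s.val + 1 < r then slot ⟨_, h⟩ ⟨0, by omega⟩ (dSlot₁ (X (⟨_, h⟩, ⟨0, by omega⟩)))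
    else post ⟨0, by omega⟩
  | slot s i t =>
    if t.val % 2 = 0 then
      (if h : s.val + 1 < r then slot ⟨_, h⟩ i (dSlot₂ (X (⟨_, h⟩, i)))
        else post ⟨2 * i.val + 1, by have := i.isLt; omega⟩)
    else
      (if h : s.val + 1 < r then
        (if h₂ : i.val + 1 < r then slot ⟨_, h⟩ ⟨_, h₂⟩ (dSlot₁ (X (⟨_, h⟩, ⟨_, h₂⟩))) else frD ⟨_, h⟩)
        else post ⟨2 * i.val + 2, by have := i.isLt; omega⟩)
  | frD s => frD s
  | post j => post j
  | pad j => if h : j.val + 1 < 2 * d then pad ⟨_, h⟩ else pad j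

/-- The symbolic PREDECESSOR (the position one to the left; `pre 0 ↦ pre 0`). -/
def predQ : QPos r d → QPos r d
  | pre j => pre ⟨j.val - 1, by have := j.isLt; omega⟩
  | frU s => if h : s.val = 0 then pre ⟨2 * r, by omega⟩ else frD ⟨s.val - 1, by have := s.isLt; omega⟩
  | slot s i t =>
    if t.val = 0 then (if h : i.val = 0 then frU s else slot s ⟨i.val - 1, by have := i.isLt; omega⟩ 3)
    else slot s i ⟨t.val - 1, by have := t.isLt; omega⟩
  | frD s => slot s ⟨r - 1, by have := s.isLt; omega⟩ 3
  | post j =>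
    if j.val = 0 then (if h : 0 < r then frD ⟨r - 1, by omega⟩ else pre ⟨2 * r, by omega⟩)
    else post ⟨j.val - 1, by have := j.isLt; omega⟩
  | pad j => if j.val = 0 then post ⟨2 * r, by omega⟩ else pad ⟨j.val - 1, by have := j.isLt; omega⟩

end QPos

/-- The DESIGN WORD of the bit matrix `X` on `Fin (2 · half r d)` (`true` = push; `d` = number of padding pairs). -/
def word {r : ℕ} (d : ℕ) (X : Fin r × Fin r → Bool) : Fin (2 * half r d) → Bool := fun p => QPos.isU X (QPos.ofFin p)

/-- The DESIGN of a bit matrix `X`: the FIFO (queue) pairing (`Literature…fifo`: `k`-th push with `k`-th pop) of its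
layout-B word — a nest-free perfect matching of `Fin (2 · half r d)` (sequel `…Counts.lean`: the word is a balanced ballot
word, so the `dite` takes its first branch, `design_eq_fifo`). -/
def design {r : ℕ} (d : ℕ) (X : Fin r × Fin r → Bool) : Fin (2 * half r d) → Fin (2 * half r d) := fun p =>
  if h : (closerSet (word d X)).card = (openerSet (word d X)).card then fifo (word d X) h p else p

/-- The allowed-arc set `E′ ∪ pad` of layout B as a set of coordinates `(opener, closer)` of `Fin (2n) × Fin (2n)`. -/
def allowed (r d : ℕ) : Finset (Fin (2 * half r d) × Fin (2 * half r d)) :=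
  univ.filter fun e => QPos.adj (QPos.ofFin e.1) (QPos.ofFin e.2) = true

/-- The COORDINATE MAP of the face projection: the pattern coordinate `((u,v),(a,b))` of an interaction pair `uv` reads
the arc "push of `u` in the slot it has under bit `a` → pop of `v` in the slot it has under bit `b`" (vertical pair:
first push → second pop; diagonal pair: second push → first pop); non-pairs read the identically-zero diagonal
coordinate `(0, 0)`. -/
def coordMap (r d : ℕ) (q : (QGV r × QGV r) × Bool × Bool) : Fin (2 * half r d) × Fin (2 * half r d) :=
  if q.1.2.1.val = q.1.1.1.val + 1 ∧ q.1.2.2.val = q.1.1.2.val then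
    (QPos.toFin (QPos.slot q.1.1.1 q.1.1.2 (QPos.uSlot₁ q.2.1)), QPos.toFin (QPos.slot q.1.2.1 q.1.2.2 (QPos.dSlot₂ q.2.2)))
  else if q.1.2.1.val = q.1.1.1.val + 1 ∧ q.1.2.2.val = q.1.1.2.val + 1 then
    (QPos.toFin (QPos.slot q.1.1.1 q.1.1.2 (QPos.uSlot₂ q.2.1)), QPos.toFin (QPos.slot q.1.2.1 q.1.2.2 (QPos.dSlot₁ q.2.2)))
  else (QPos.toFin (QPos.pre ⟨0, by omega⟩), QPos.toFin (QPos.pre ⟨0, by omega⟩))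

end Summit.ValiantsHypothesis.ValiantsHypothesis.Theorems.FifoMatching.NFPolytopeQuasiPolyXC.QueueGridFace
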